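import Mathlib
import Literature.Analysis.ValidatedNumerics.TaylorModelIntegralCertTrig
import Literature.Analysis.ValidatedNumerics.TaylorModelExpr
import Summits.Ventures.FusionMHD.Models.CerfonFreidbergIterLikeQHalfMercDefs
import Summits.Ventures.FusionMHD.Models.CerfonFreidbergIterLikeQHalfGGJ
import HarnessLib

/-!
# Ventures/FusionMHD — Models/CerfonFreidbergIterLikeQHalfMercSound.lean: SOUNDNESS of the Mercier-register obligation at `ψ_N = 1/2` of THE
# Cerfon–Freidberg ITER-like instance — what `CFIterLike.QHalfMerc.MercCert.ok = true` MEANS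

HONEST FRAMING (LADDER-GRIDFUSION three columns; CF rung; «F2.R2-CF-MERCIER-IMPLICIT» step (3), F2-SCOPING v1.6 §10(c)).
The 137-statement block `CFIterLike.QHalfMerc.block3M` is executed symbolically in TWO pieces: `b3a` (113 statements: `U_X, U_Y ⇒ G = U_X² + U_Y²`) and
`b3b` (24: the `V″`-numerator, `X·D`, `((X·D)²·D)⁻¹`, `K_W`, `(X·D·G)⁻¹`, `K_Aσ`, `K_AR`, `K_B1`, the four tops `× p`), with `block3M = b3a ++ b3b` by `rfl`;
model-5 g8's `QHalfShear.block1_regs` / `block2_regs` (ANY incoming stack) are used BY NAME for the first 243 statements.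
* §1 `b3a_regs` / `b3b_regs` — register semantics for ANY incoming stack described by hypotheses (closed forms `CFIterLike.QHalf.UXc`, `UYc`);
* §2 at THE instance (`CFIterLike.QHalf.params`, `mA` = ★ #117's approximant): **`progM_regs`** — the four top registers ARE
  `g_B1 = m·((X·D)·G)⁻¹·π`, `g_AR = X²·(X²·m·((X·D)·G)⁻¹)·π`, `g_Aσ = X²·m·((X·D)·G)⁻¹·π`, `g_W = ((X_a + 2m cos)·D − X·m·F2)·X²·(((X·D)·(X·D))·D)⁻¹·π`
  along `mA` with `X = X_a + mA t cos(πt)`, `D = Dfield (πt) (mA t)`, `F2 = F2field (πt) (mA t)`, `G = Gfield (πt) (mA t)` (model-7's fields) — the link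
  file identifies them with `volKernelDs/D`, `invGradKernel`, `R²·volKernel/G`, `volKernel/(R²G)` where `X, D, G ≠ 0`;
* §3 **`sound_of_ok`**: `MercCert.ok d = true` ⇒ the four `FSegOK` segment facts on panel `d.j` (any register of an accepted run is enclosed by
  its Taylor model — `TProg.stackMem_model` — and `fsegOK_of_tmem`; measurability of register functions by structural induction, re-proved here
  because the lane's lemma is private).
MODELLED: analytic Cerfon–Freidberg family; nothing about a device or stability.  No `decide`.  Typer/prover: gridfusion-model-7 (g7), 2026-08-27.
Citations: Jardin 2010 §8.5 (8.134) [Jardin2010]; Melquiond 2008 §3.3 [Melquiond2008]; Mahboubi–Melquiond–Sibut-Pinote 2016 §3.2 Lemma 3, §4.1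
[MahboubiMelquiondSibutpinote2016].
-/

noncomputable section

open Set
open Literature.Analysis.ValidatedNumerics Literature.Analysis.ValidatedNumerics.PolyMP
open Literature.Analysis.ValidatedNumerics.NumericsMP Literature.Analysis.ValidatedNumerics.ExpPoly
open Literature.MathematicalPhysics.MHD Literature.MathematicalPhysics.MHD.CerfonFreidberg

set_option autoImplicit false

namespace Summit.Ventures.FusionMHD.Models.CFIterLike.QHalfMerc

set_option maxRecDepth 100000

/-! ## §0 Register functions of a run are measurable (structural induction; the lane's own lemma is private) -/

/-- Every statement denotes a measurable function of measurable registers. [folklore] -/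
theorem measurable_evalF_base' {fs : List (ℝ → ℝ)} (hfs : ∀ i, Measurable (getReg (fun _ => (0 : ℝ)) fs i)) :
    ∀ op : SOp, Measurable (op.evalF fs)
  | SOp.poly g => (Poly.continuous_eval g).measurable
  | SOp.expAff a b => by
      show Measurable fun t : ℝ => Real.exp ((a : ℝ) + b * t)
      exact Real.measurable_exp.comp (measurable_const.add (measurable_const.mul measurable_id))
  | SOp.neg i => (hfs i).neg
  | SOp.add i j => (hfs i).add (hfs j)
  | SOp.mul i j => (hfs i).mul (hfs j)
  | SOp.inv i => (hfs i).inv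
  | SOp.sqrt i => Real.continuous_sqrt.measurable.comp (hfs i)
  | SOp.log i => Real.measurable_log.comp (hfs i)
  | SOp.exp i => Real.measurable_exp.comp (hfs i)

/-- … trigonometric statements included. [folklore] -/
theorem measurable_evalF_T' {fs : List (ℝ → ℝ)} (hfs : ∀ i, Measurable (getReg (fun _ => (0 : ℝ)) fs i)) :
    ∀ op : TOp, Measurable (op.evalF fs)
  | TOp.base op => measurable_evalF_base' hfs op
  | TOp.sin i => Real.measurable_sin.comp (hfs i)
  | TOp.cos i => Real.measurable_cos.comp (hfs i)

/-- Consing a measurable register keeps all registers measurable. [folklore] -/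
theorem measurable_getReg_cons' {f : ℝ → ℝ} {fs : List (ℝ → ℝ)} (hf : Measurable f)
    (hfs : ∀ i, Measurable (getReg (fun _ => (0 : ℝ)) fs i)) :
    ∀ i, Measurable (getReg (fun _ => (0 : ℝ)) (f :: fs) i)
  | 0 => by rw [getReg_cons_zero]; exact hf
  | i + 1 => by rw [getReg_cons_succ]; exact hfs i

/-- **Every register of a run on measurable registers is measurable.** [folklore] -/
theorem measurable_runF' : ∀ (q : TProg) (fs : List (ℝ → ℝ)),
    (∀ i, Measurable (getReg (fun _ => (0 : ℝ)) fs i)) → ∀ i, Measurable (getReg (fun _ => (0 : ℝ)) (q.runF fs) i)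
  | [], fs, hfs => by simpa [TProg.runF] using hfs
  | op :: q, fs, hfs => by
      rw [TProg.runF]
      exact measurable_runF' q _ (measurable_getReg_cons' (measurable_evalF_T' hfs op) hfs)

/-- The constant initial stack is measurable. [folklore] -/
theorem measurable_constStack' : ∀ (ps : List ℝ) (i : ℕ), Measurable (getReg (fun _ => (0 : ℝ)) (constStack ps) i)
  | [], i => by simp [constStack, getReg_nil]
  | x :: ps, 0 => by simp [constStack]
  | x :: ps, i + 1 => by simpa [constStack] using measurable_constStack' ps i

/-! ## §1 The two pieces of `block3M` and their symbolic execution -/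

/-- Piece `b3a` of `block3M` (113 statements): `U_X, U_Y ⇒ G`. -/
def b3a : TProg :=
  [TOp.base (SOp.poly [2]), TOp.base (SOp.mul 0 541), TOp.base (SOp.neg 543), TOp.base (SOp.add 1 0),
   TOp.base (SOp.poly [(-8)]), TOp.base (SOp.mul 0 547), TOp.base (SOp.poly [(-30)]), TOp.base (SOp.mul 0 550),
   TOp.base (SOp.add 2 0), TOp.base (SOp.poly [16]), TOp.base (SOp.mul 0 554), TOp.base (SOp.poly [(-400)]),
   TOp.base (SOp.mul 0 557), TOp.base (SOp.add 2 0), TOp.base (SOp.mul 0 247), TOp.base (SOp.add 6 0),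
   TOp.base (SOp.mul 0 249), TOp.base (SOp.add 13 0), TOp.base (SOp.poly [(1 / 2)]), TOp.base (SOp.poly [4]),
   TOp.base (SOp.mul 0 562), TOp.base (SOp.add 2 0), TOp.base (SOp.poly [3]), TOp.base (SOp.mul 0 566),
   TOp.base (SOp.add 2 0), TOp.base (SOp.poly [(-48)]), TOp.base (SOp.mul 0 570), TOp.base (SOp.poly [480]),
   TOp.base (SOp.mul 0 573), TOp.base (SOp.add 2 0), TOp.base (SOp.mul 0 263), TOp.base (SOp.add 6 0),
   TOp.base (SOp.poly [6]), TOp.base (SOp.mul 0 577), TOp.base (SOp.poly [(-15)]), TOp.base (SOp.mul 0 580),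
   TOp.base (SOp.add 2 0), TOp.base (SOp.mul 0 271), TOp.base (SOp.add 6 0), TOp.base (SOp.mul 0 273),
   TOp.base (SOp.add 22 0), TOp.base (SOp.mul 278 0), TOp.base (SOp.poly [(-2)]), TOp.base (SOp.mul 0 584),
   TOp.base (SOp.poly [(-24)]), TOp.base (SOp.mul 0 588), TOp.base (SOp.poly [(-240)]), TOp.base (SOp.mul 0 592),
   TOp.base (SOp.mul 0 281), TOp.base (SOp.add 3 0), TOp.base (SOp.mul 0 283), TOp.base (SOp.add 7 0),
   TOp.base (SOp.poly [12]), TOp.base (SOp.mul 0 596), TOp.base (SOp.poly [720]), TOp.base (SOp.mul 0 600),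
   TOp.base (SOp.mul 0 289), TOp.base (SOp.add 3 0), TOp.base (SOp.poly [(-90)]), TOp.base (SOp.mul 0 604),
   TOp.base (SOp.mul 0 294), TOp.base (SOp.add 3 0), TOp.base (SOp.mul 0 296), TOp.base (SOp.add 11 0),
   TOp.base (SOp.mul 301 0), TOp.base (SOp.mul 300 0), TOp.base (SOp.add 24 0), TOp.base (SOp.mul 66 608),
   TOp.base (SOp.poly [8]), TOp.base (SOp.mul 0 612), TOp.base (SOp.poly [48]), TOp.base (SOp.mul 0 616),
   TOp.base (SOp.mul 0 305), TOp.base (SOp.add 3 0), TOp.base (SOp.mul 0 307), TOp.base (SOp.add 7 0),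
   TOp.base (SOp.mul 312 0), TOp.base (SOp.poly [(-18)]), TOp.base (SOp.mul 0 621), TOp.base (SOp.add 73 0),
   TOp.base (SOp.poly [32]), TOp.base (SOp.mul 0 625), TOp.base (SOp.poly [(-560)]), TOp.base (SOp.mul 0 628),
   TOp.base (SOp.add 2 0), TOp.base (SOp.mul 0 318), TOp.base (SOp.add 6 0), TOp.base (SOp.mul 323 0),
   TOp.base (SOp.mul 43 632), TOp.base (SOp.poly [150]), TOp.base (SOp.mul 0 635), TOp.base (SOp.add 2 0),
   TOp.base (SOp.mul 328 0), TOp.base (SOp.mul 0 327), TOp.base (SOp.add 6 0), TOp.base (SOp.mul 0 329),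
   TOp.base (SOp.add 19 0), TOp.base (SOp.poly [(-480)]), TOp.base (SOp.mul 0 643), TOp.base (SOp.mul 0 332),
   TOp.base (SOp.add 54 0), TOp.base (SOp.mul 337 0), TOp.base (SOp.poly [360]), TOp.base (SOp.mul 0 648),
   TOp.base (SOp.mul 340 0), TOp.base (SOp.mul 0 339), TOp.base (SOp.add 4 0), TOp.base (SOp.mul 0 341),
   TOp.base (SOp.mul 343 0), TOp.base (SOp.add 12 0), TOp.base (SOp.mul 43 43), TOp.base (SOp.mul 1 1),
   TOp.base (SOp.add 1 0)]

/-- Piece `b3b` of `block3M` (24 statements): numerator, `X·D`, the two `inv`s, the kernels, the tops. -/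
def b3b : TProg :=
  [TOp.base (SOp.mul 356 353), TOp.base (SOp.mul 113 0), TOp.base (SOp.add 661 0), TOp.base (SOp.mul 0 236),
   TOp.base (SOp.mul 354 360), TOp.base (SOp.mul 0 118), TOp.base (SOp.neg 0), TOp.base (SOp.add 3 0),
   TOp.base (SOp.mul 358 241), TOp.base (SOp.mul 0 0), TOp.base (SOp.mul 0 243), TOp.base (SOp.inv 0),
   TOp.base (SOp.mul 4 359), TOp.base (SOp.mul 0 1), TOp.base (SOp.mul 5 14), TOp.base (SOp.inv 0),
   TOp.base (SOp.mul 363 372), TOp.base (SOp.mul 0 1), TOp.base (SOp.mul 365 0), TOp.base (SOp.mul 375 3),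
   TOp.base (SOp.mul 6 681), TOp.base (SOp.mul 3 682), TOp.base (SOp.mul 3 683), TOp.base (SOp.mul 3 684)]

/-- `block3M` is the concatenation of its two pieces. -/
theorem block3M_split : CFIterLike.QHalfMerc.block3M = b3a ++ b3b := rfl

/-- Lengths of the pieces. -/
theorem b3_lengths : CFIterLike.QHalfMerc.b3a.length = 113 ∧ b3b.length = 24 := by decide

set_option maxHeartbeats 4000000 in
/-- **Piece `b3a`**: for any stack carrying `X, Y, log X, X·X, Y·Y` at depths 237, 236, 235, 234, 233 and `c₁…c₆` at depths 540…545, after `b3a`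
the top register is `G = U_X² + U_Y²` (closed forms), `U_Y` is at depth 3, `U_X` at depth 46, and the constant `2` at depth 112. -/
theorem b3a_regs (stk : List (ℝ → ℝ)) (c : Fin 7 → ℝ) (Xa p : ℝ) (f0 : ℝ → ℝ)
    (hX : getReg (fun _ => (0 : ℝ)) stk 237 = (fun t => Xa + f0 t * Real.cos (p * t)))
    (hY : getReg (fun _ => (0 : ℝ)) stk 236 = (fun t => f0 t * Real.sin (p * t)))
    (hL : getReg (fun _ => (0 : ℝ)) stk 235 = (fun t => Real.log (Xa + f0 t * Real.cos (p * t))))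
    (hXX : getReg (fun _ => (0 : ℝ)) stk 234 = (fun t => (Xa + f0 t * Real.cos (p * t)) * (Xa + f0 t * Real.cos (p * t))))
    (hYY : getReg (fun _ => (0 : ℝ)) stk 233 = (fun t => (f0 t * Real.sin (p * t)) * (f0 t * Real.sin (p * t))))
    (hc1 : getReg (fun _ => (0 : ℝ)) stk 540 = fun _ => c 1)
    (hc2 : getReg (fun _ => (0 : ℝ)) stk 541 = fun _ => c 2)
    (hc3 : getReg (fun _ => (0 : ℝ)) stk 542 = fun _ => c 3)
    (hc4 : getReg (fun _ => (0 : ℝ)) stk 543 = fun _ => c 4)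
    (hc5 : getReg (fun _ => (0 : ℝ)) stk 544 = fun _ => c 5)
    (hc6 : getReg (fun _ => (0 : ℝ)) stk 545 = fun _ => c 6) :
    getReg (fun _ => (0 : ℝ)) (TProg.runF CFIterLike.QHalfMerc.b3a stk) 0
      = (fun t => CFIterLike.QHalf.UXc c (Xa + f0 t * Real.cos (p * t)) (f0 t * Real.sin (p * t)) ^ 2 + CFIterLike.QHalf.UYc c (Xa + f0 t * Real.cos (p * t)) (f0 t * Real.sin (p * t)) ^ 2)
    ∧ getReg (fun _ => (0 : ℝ)) (TProg.runF b3a stk) 3 = (fun t => CFIterLike.QHalf.UYc c (Xa + f0 t * Real.cos (p * t)) (f0 t * Real.sin (p * t)))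
    ∧ getReg (fun _ => (0 : ℝ)) (TProg.runF b3a stk) 46 = (fun t => CFIterLike.QHalf.UXc c (Xa + f0 t * Real.cos (p * t)) (f0 t * Real.sin (p * t)))
    ∧ getReg (fun _ => (0 : ℝ)) (TProg.runF b3a stk) 112 = (fun _ => (2 : ℝ)) := by
  simp only [b3a, TProg.runF, TOp.evalF, SOp.evalF, getReg_cons_zero, getReg_cons_succ, hX, hY, hL, hXX, hYY, hc1, hc2, hc3, hc4, hc5,
    hc6, Poly.eval_cons, Poly.eval_nil, add_zero, mul_zero]
  refine ⟨?_, ?_, ?_, ?_⟩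
  · funext t; simp only [CFIterLike.QHalf.UXc, CFIterLike.QHalf.UYc]; push_cast; ring
  · funext t; simp only [CFIterLike.QHalf.UYc]; push_cast; ring
  · funext t; simp only [CFIterLike.QHalf.UXc]; push_cast; ring
  · rfl

/-- **Piece `b3b`**: for any stack carrying `G` on top, the constant `2` at depth 112, `F2` at 113, `D` at 233, `X` at 350, `X·X` at 347, `cos` at 353, `m` at 356,
`X_a, p` at depths 659, 661, after `b3b` the four top registers are the explicit products below. -/
theorem b3b_regs (stk : List (ℝ → ℝ)) (Xa p : ℝ) (f0 FX FXX Fct FD FF2 FG : ℝ → ℝ)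
    (hG : getReg (fun _ => (0 : ℝ)) stk 0 = FG)
    (h2 : getReg (fun _ => (0 : ℝ)) stk 112 = fun _ => (2 : ℝ))
    (hF2 : getReg (fun _ => (0 : ℝ)) stk 113 = FF2)
    (hD : getReg (fun _ => (0 : ℝ)) stk 233 = FD)
    (hX : getReg (fun _ => (0 : ℝ)) stk 350 = FX)
    (hXX : getReg (fun _ => (0 : ℝ)) stk 347 = FXX)
    (hct : getReg (fun _ => (0 : ℝ)) stk 353 = Fct)
    (hm : getReg (fun _ => (0 : ℝ)) stk 356 = f0)
    (hXa : getReg (fun _ => (0 : ℝ)) stk 659 = fun _ => Xa)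
    (hp : getReg (fun _ => (0 : ℝ)) stk 661 = fun _ => p) :
    getReg (fun _ => (0 : ℝ)) (TProg.runF CFIterLike.QHalfMerc.b3b stk) 0 = (fun t => ((f0 t * (((FX t * FD t) * FG t))⁻¹) * p))
    ∧ getReg (fun _ => (0 : ℝ)) (TProg.runF b3b stk) 1 = (fun t => ((FXX t * ((FXX t * f0 t) * (((FX t * FD t) * FG t))⁻¹)) * p))
    ∧ getReg (fun _ => (0 : ℝ)) (TProg.runF b3b stk) 2 = (fun t => (((FXX t * f0 t) * (((FX t * FD t) * FG t))⁻¹) * p))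
    ∧ getReg (fun _ => (0 : ℝ)) (TProg.runF b3b stk) 3 = (fun t => ((((((Xa + ((2 : ℝ) * (f0 t * Fct t))) * FD t) + (-((FX t * f0 t) * FF2 t))) * FXX t) * ((((FX t * FD t) * (FX t * FD t)) * FD t))⁻¹) * p)) := by
  simp only [b3b, TProg.runF, TOp.evalF, SOp.evalF, getReg_cons_zero, getReg_cons_succ, hG, h2, hF2, hD, hX, hXX, hct, hm, hXa, hp,
    and_self]

/-! ## §2 The four top registers at THE instance -/

/-- `X` along the approximant: `X_a + mA t·cos(πt)`. -/
def XA (t : ℝ) : ℝ := Xa + CFIterLike.QHalf.mA t * Real.cos (Real.pi * t)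
/-- `∂_s D_r` along the approximant: `F2field (πt) (mA t)`. -/
def F2A (t : ℝ) : ℝ := CFIterLike.QHalf.F2field (Real.pi * t) (CFIterLike.QHalf.mA t)
/-- `|∇U|²` along the approximant: `Gfield (πt) (mA t)`. -/
def GA (t : ℝ) : ℝ := CFIterLike.QHalf.Gfield (Real.pi * t) (CFIterLike.QHalf.mA t)

/-- Register function of `g_B1` along the approximant (`m·((X·D)·G)⁻¹·π`). -/
def gB1A (t : ℝ) : ℝ := CFIterLike.QHalf.mA t * ((XA t * CFIterLike.QHalf.DrA t) * GA t)⁻¹ * Real.pi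
/-- Register function of `g_AR` (`X²·(X²·m·((X·D)·G)⁻¹)·π`). -/
def gARA (t : ℝ) : ℝ := (XA t * XA t) * ((XA t * XA t) * CFIterLike.QHalf.mA t * ((XA t * CFIterLike.QHalf.DrA t) * GA t)⁻¹) * Real.pi
/-- Register function of `g_Aσ` (`X²·m·((X·D)·G)⁻¹·π`). -/
def gAsA (t : ℝ) : ℝ := (XA t * XA t) * CFIterLike.QHalf.mA t * ((XA t * CFIterLike.QHalf.DrA t) * GA t)⁻¹ * Real.pi
/-- Register function of `g_W` (`((X_a + 2 m cos)·D − X·m·F2)·X²·(((X·D)·(X·D))·D)⁻¹·π`). -/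
def gWA (t : ℝ) : ℝ :=
  ((Xa + 2 * (CFIterLike.QHalf.mA t * Real.cos (Real.pi * t))) * CFIterLike.QHalf.DrA t + -(XA t * CFIterLike.QHalf.mA t * F2A t)) * (XA t * XA t)
    * (((XA t * CFIterLike.QHalf.DrA t) * (XA t * CFIterLike.QHalf.DrA t)) * CFIterLike.QHalf.DrA t)⁻¹ * Real.pi

/-- **THE FOUR TOP REGISTERS OF `progM` AT THE INSTANCE** are `gB1A, gARA, gAsA, gWA`. -/
theorem progM_regs :
    getReg (fun _ => (0 : ℝ)) (TProg.runF CFIterLike.QHalfMerc.progM (constStack CFIterLike.QHalf.params)) 0 = gB1A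
    ∧ getReg (fun _ => (0 : ℝ)) (TProg.runF CFIterLike.QHalfMerc.progM (constStack CFIterLike.QHalf.params)) 1 = gARA
    ∧ getReg (fun _ => (0 : ℝ)) (TProg.runF CFIterLike.QHalfMerc.progM (constStack CFIterLike.QHalf.params)) 2 = gAsA
    ∧ getReg (fun _ => (0 : ℝ)) (TProg.runF CFIterLike.QHalfMerc.progM (constStack CFIterLike.QHalf.params)) 3 = gWA := by
  have hrun : TProg.runF progM (constStack CFIterLike.QHalf.params)
      = TProg.runF b3b (TProg.runF b3a (TProg.runF QHalfShear.block2 (TProg.runF QHalfShear.block1 CFIterLike.QHalf.stkA))) := by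
    rw [progM, block3M_split, CFIterLike.QHalf.runF_append, CFIterLike.QHalf.runF_append, CFIterLike.QHalf.runF_append, CFIterLike.QHalf.runF_append]; rfl
  have hP : ∀ i, getReg (fun _ => (0 : ℝ)) CFIterLike.QHalf.stkA (296 + i) = getReg (fun _ => (0 : ℝ)) (constStack CFIterLike.QHalf.params) i := CFIterLike.QHalf.stkA_param
  have h1 := QHalfShear.block1_regs CFIterLike.QHalf.stkA coeff Xa (U Xa 0) Real.pi CFIterLike.QHalf.mA CFIterLike.QHalf.stkA_top
    (by rw [hP 0]; simp [constStack, CFIterLike.QHalf.params]) (by rw [hP 1]; simp [constStack, CFIterLike.QHalf.params]) (by rw [hP 2]; simp [constStack, CFIterLike.QHalf.params])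
    (by rw [hP 3]; simp [constStack, CFIterLike.QHalf.params]) (by rw [hP 4]; simp [constStack, CFIterLike.QHalf.params]) (by rw [hP 5]; simp [constStack, CFIterLike.QHalf.params])
    (by rw [hP 6]; simp [constStack, CFIterLike.QHalf.params]) (by rw [hP 7]; simp [constStack, CFIterLike.QHalf.params]) (by rw [hP 8]; simp [constStack, CFIterLike.QHalf.params])
    (by rw [hP 9]; simp [constStack, CFIterLike.QHalf.params])
  obtain ⟨hD, hX, hY, hL, hXX, hYY, hct, hst, hm, e306, e307, e311, e316, e331, e351, e357, e358, e373, e385, e397, e409⟩ := h1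
  set stk1 := TProg.runF QHalfShear.block1 CFIterLike.QHalf.stkA with hstk1
  have hP1 : ∀ i, getReg (fun _ => (0 : ℝ)) stk1 (123 + i) = getReg (fun _ => (0 : ℝ)) CFIterLike.QHalf.stkA i := by
    intro i; rw [hstk1, ← QHalfShear.block_lengths.1]; exact CFIterLike.QHalf.getReg_runF_add _ QHalfShear.block1 _ i
  have q : ∀ j : ℕ, getReg (fun _ => (0 : ℝ)) stk1 (123 + (296 + j)) = getReg (fun _ => (0 : ℝ)) (constStack CFIterLike.QHalf.params) j :=
    fun j => (hP1 (296 + j)).trans (hP j)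
  have h2 := QHalfShear.block2_regs stk1 coeff Xa (U Xa 0) Real.pi CFIterLike.QHalf.mA hX hY hL hXX hYY hct hst e306 e307 e311 e316 e331 e351 e357 e358 e373 e385 e397 e409
    (by rw [show (419 : ℕ) = 123 + (296 + 0) by norm_num, q 0]; simp [constStack, CFIterLike.QHalf.params]) (by rw [show (420 : ℕ) = 123 + (296 + 1) by norm_num, q 1]; simp [constStack, CFIterLike.QHalf.params])
    (by rw [show (421 : ℕ) = 123 + (296 + 2) by norm_num, q 2]; simp [constStack, CFIterLike.QHalf.params]) (by rw [show (422 : ℕ) = 123 + (296 + 3) by norm_num, q 3]; simp [constStack, CFIterLike.QHalf.params])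
    (by rw [show (423 : ℕ) = 123 + (296 + 4) by norm_num, q 4]; simp [constStack, CFIterLike.QHalf.params]) (by rw [show (424 : ℕ) = 123 + (296 + 5) by norm_num, q 5]; simp [constStack, CFIterLike.QHalf.params])
    (by rw [show (425 : ℕ) = 123 + (296 + 6) by norm_num, q 6]; simp [constStack, CFIterLike.QHalf.params]) (by rw [show (426 : ℕ) = 123 + (296 + 7) by norm_num, q 7]; simp [constStack, CFIterLike.QHalf.params])
    (by rw [show (427 : ℕ) = 123 + (296 + 8) by norm_num, q 8]; simp [constStack, CFIterLike.QHalf.params]) (by rw [show (428 : ℕ) = 123 + (296 + 9) by norm_num, q 9]; simp [constStack, CFIterLike.QHalf.params])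
  set stk2 := TProg.runF QHalfShear.block2 stk1 with hstk2
  have hP2 : ∀ i, getReg (fun _ => (0 : ℝ)) stk2 (120 + i) = getReg (fun _ => (0 : ℝ)) stk1 i := by
    intro i; rw [hstk2, ← QHalfShear.block_lengths.2.1]; exact CFIterLike.QHalf.getReg_runF_add _ QHalfShear.block2 _ i
  have q2 : ∀ j : ℕ, getReg (fun _ => (0 : ℝ)) stk2 (120 + (123 + (296 + j))) = getReg (fun _ => (0 : ℝ)) (constStack CFIterLike.QHalf.params) j :=
    fun j => (hP2 _).trans (q j)
  have h3 := b3a_regs stk2 coeff Xa Real.pi CFIterLike.QHalf.mA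
    (by rw [show (237 : ℕ) = 120 + 117 by norm_num, hP2, hX]) (by rw [show (236 : ℕ) = 120 + 116 by norm_num, hP2, hY])
    (by rw [show (235 : ℕ) = 120 + 115 by norm_num, hP2, hL]) (by rw [show (234 : ℕ) = 120 + 114 by norm_num, hP2, hXX])
    (by rw [show (233 : ℕ) = 120 + 113 by norm_num, hP2, hYY])
    (by rw [show (540 : ℕ) = 120 + (123 + (296 + 1)) by norm_num, q2 1]; simp [constStack, CFIterLike.QHalf.params])
    (by rw [show (541 : ℕ) = 120 + (123 + (296 + 2)) by norm_num, q2 2]; simp [constStack, CFIterLike.QHalf.params])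
    (by rw [show (542 : ℕ) = 120 + (123 + (296 + 3)) by norm_num, q2 3]; simp [constStack, CFIterLike.QHalf.params])
    (by rw [show (543 : ℕ) = 120 + (123 + (296 + 4)) by norm_num, q2 4]; simp [constStack, CFIterLike.QHalf.params])
    (by rw [show (544 : ℕ) = 120 + (123 + (296 + 5)) by norm_num, q2 5]; simp [constStack, CFIterLike.QHalf.params])
    (by rw [show (545 : ℕ) = 120 + (123 + (296 + 6)) by norm_num, q2 6]; simp [constStack, CFIterLike.QHalf.params])
  obtain ⟨hG, -, -, h2c⟩ := h3
  set stk3 := TProg.runF b3a stk2 with hstk3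
  have hP3 : ∀ i, getReg (fun _ => (0 : ℝ)) stk3 (113 + i) = getReg (fun _ => (0 : ℝ)) stk2 i := by
    intro i; rw [hstk3, ← b3_lengths.1]; exact CFIterLike.QHalf.getReg_runF_add _ b3a _ i
  have q3 : ∀ j : ℕ, getReg (fun _ => (0 : ℝ)) stk3 (113 + (120 + (123 + (296 + j)))) = getReg (fun _ => (0 : ℝ)) (constStack CFIterLike.QHalf.params) j :=
    fun j => (hP3 _).trans (q2 j)
  have h4 := b3b_regs stk3 Xa Real.pi CFIterLike.QHalf.mA XA (fun t => XA t * XA t) (fun t => Real.cos (Real.pi * t)) CFIterLike.QHalf.DrA F2A GA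
    (by rw [hG]; funext t; simp only [GA, CFIterLike.QHalf.Gfield])
    (by rw [show (112 : ℕ) = 112 by rfl]; exact h2c)
    (by rw [show (113 : ℕ) = 113 + 0 by norm_num, hP3, h2]; funext t; simp only [F2A, CFIterLike.QHalf.F2field])
    (by rw [show (233 : ℕ) = 113 + 120 by norm_num, hP3, show (120 : ℕ) = 120 + 0 by norm_num, hP2, hD]; funext t; simp only [CFIterLike.QHalf.DrA])
    (by rw [show (350 : ℕ) = 113 + (120 + 117) by norm_num, hP3, hP2, hX]; funext t; simp only [XA])
    (by rw [show (347 : ℕ) = 113 + (120 + 114) by norm_num, hP3, hP2, hXX]; funext t; simp only [XA])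
    (by rw [show (353 : ℕ) = 113 + (120 + 120) by norm_num, hP3, hP2, hct])
    (by rw [show (356 : ℕ) = 113 + (120 + 123) by norm_num, hP3, hP2, hm])
    (by rw [show (659 : ℕ) = 113 + (120 + (123 + (296 + 7))) by norm_num, q3 7]; simp [constStack, CFIterLike.QHalf.params])
    (by rw [show (661 : ℕ) = 113 + (120 + (123 + (296 + 9))) by norm_num, q3 9]; simp [constStack, CFIterLike.QHalf.params])
  rw [hrun]
  obtain ⟨g0, g1, g2, g3⟩ := h4
  refine ⟨?_, ?_, ?_, ?_⟩
  · rw [g0]; funext t; simp only [gB1A]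
  · rw [g1]; funext t; simp only [gARA]
  · rw [g2]; funext t; simp only [gAsA]
  · rw [g3]; funext t; simp only [gWA]

/-! ## §3 Soundness of the per-panel obligation -/

/-- **SOUNDNESS OF `MercCert.ok`**: the lane's integral segments of the four register functions hold with the claimed bounds on panel `d.j`. -/
theorem sound_of_ok {d : CFIterLike.QHalfMerc.MercCert} (h : d.ok = true) :
    FSegOK gWA [1] CFIterLike.QHalf.tmS (panelLeft CFIterLike.QHalf.hw d.j) (panelLeft CFIterLike.QHalf.hw (d.j + 1)) d.wlo d.whi
    ∧ FSegOK gAsA [1] CFIterLike.QHalf.tmS (panelLeft CFIterLike.QHalf.hw d.j) (panelLeft CFIterLike.QHalf.hw (d.j + 1)) d.slo d.shi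
    ∧ FSegOK gARA [1] CFIterLike.QHalf.tmS (panelLeft CFIterLike.QHalf.hw d.j) (panelLeft CFIterLike.QHalf.hw (d.j + 1)) d.rlo d.rhi
    ∧ FSegOK gB1A [1] CFIterLike.QHalf.tmS (panelLeft CFIterLike.QHalf.hw d.j) (panelLeft CFIterLike.QHalf.hw (d.j + 1)) d.blo d.bhi := by
  simp only [MercCert.ok, integ, Bool.and_eq_true, decide_eq_true_eq] at h
  obtain ⟨⟨⟨⟨⟨⟨⟨⟨hok, hwlo⟩, hwhi⟩, hslo⟩, hshi⟩, hrlo⟩, hrhi⟩, hblo⟩, hbhi⟩ := h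
  unfold panelModels at hok hwlo hwhi hslo hshi hrlo hrhi hblo hbhi
  have hst := TProg.stackMem_model CFIterLike.QHalf.tmS_pos CFIterLike.QHalf.hw_pos.le (CFIterLike.QHalf.ctr d.j) progM (stackMem_const CFIterLike.QHalf.tmS CFIterLike.QHalf.hw (CFIterLike.QHalf.ctr d.j) CFIterLike.QHalf.boxMem_params) _ hok
  have hmeas : ∀ i, Measurable (getReg (fun _ => (0 : ℝ)) (TProg.runF progM (constStack CFIterLike.QHalf.params)) i) :=
    measurable_runF' progM _ (measurable_constStack' CFIterLike.QHalf.params)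
  obtain ⟨g0, g1, g2, g3⟩ := progM_regs
  have hW3 := hst 3; have hW2 := hst 2; have hW1 := hst 1; have hW0 := hst 0
  have hm3 := hmeas 3; have hm2 := hmeas 2; have hm1 := hmeas 1; have hm0 := hmeas 0
  rw [g3] at hW3 hm3; rw [g2] at hW2 hm2; rw [g1] at hW1 hm1; rw [g0] at hW0 hm0
  rw [← CFIterLike.QHalf.pc_eq] at hW3 hW2 hW1 hW0 hwlo hwhi hslo hshi hrlo hrhi hblo hbhi
  exact ⟨fsegOK_of_tmem CFIterLike.QHalf.tmS_pos CFIterLike.QHalf.hw_pos hm3 [1] d.j hW3 hwlo hwhi, fsegOK_of_tmem CFIterLike.QHalf.tmS_pos CFIterLike.QHalf.hw_pos hm2 [1] d.j hW2 hslo hshi,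
    fsegOK_of_tmem CFIterLike.QHalf.tmS_pos CFIterLike.QHalf.hw_pos hm1 [1] d.j hW1 hrlo hrhi, fsegOK_of_tmem CFIterLike.QHalf.tmS_pos CFIterLike.QHalf.hw_pos hm0 [1] d.j hW0 hblo hbhi⟩

end Summit.Ventures.FusionMHD.Models.CFIterLike.QHalfMerc

end
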